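import Summits.QuantumAdvantage.QuantumAdvantage.Theorems.SosSandwichPseudoBoundedAAChebyshevCalibration
import Mathlib.Analysis.SpecialFunctions.Pow.Real

/-!
# Route `SosSandwich`, crux `PseudoBoundedAA` (stmt-QuantumAdvantage-15237) — the `T`-exponent of any influence
law on `K` is at least `2`, for REAL exponents

Helper (`--supports stmt-QuantumAdvantage-15237`), conjecture-free, no named facts. Sharpens
`not_influence_law_linear_in_T` (`SosSandwichPseudoBoundedAAChebyshevCalibration.lean`, natural exponent `b = 1`)
to every real exponent `b < 2`: **no law `maxInf ≥ C·Var^a/T^b` with `b < 2` holds on the SOS sandwich class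
`K`**, whatever `a : ℕ` and `C > 0` (`not_influence_law_subquadratic_in_T`). Witness: the calibrating Chebyshev
family (`chebyshev_calibration`: order `T = 12r`, `Var ≥ 1/2592`, every influence `≤ 29/T²`), with
`T^{2−b} → ∞`. So the admissible `T`-exponent on `K` is EXACTLY delimited from below by the amplitude-amplification
profile: `b ≥ 2`, and `(a, b) = (2, 2)` is the corner (cf. `pseudoBounded_exponent_corner`). Honest label:
calibration. [folklore] [cite: BealsEtAl2001, §4]
-/

set_option linter.dupNamespace false

noncomputable section

namespace Summit.QuantumAdvantage.QuantumAdvantage.Theorems.SosSandwich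

open Finset
open Literature.Computability.QuantumComplexity

/-- **No influence law with sub-quadratic loss in `T` holds on `K`** (real exponent `b < 2`, any variance
exponent `a : ℕ`, any constant `C > 0`). [folklore] -/
theorem not_influence_law_subquadratic_in_T (a : ℕ) {b : ℝ} (hb : b < 2) :
    ¬ ∃ C : ℝ, 0 < C ∧ ∀ (N T : ℕ) (p : MvPolynomial (Fin N) ℝ), 1 ≤ T → PseudoBounded T p →
      0 < boolVariance p → ∃ i : Fin N, C * boolVariance p ^ a / (T : ℝ) ^ b ≤ influence i p := by
  rintro ⟨C, hC, h⟩
  set v : ℝ := 1 / 2592 with hv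
  have hv0 : 0 < v := by norm_num
  set K : ℝ := C * v ^ a with hK
  have hK0 : 0 < K := mul_pos hC (pow_pos hv0 a)
  have he : 0 < 2 - b := by linarith
  -- a threshold `M` with `M^{2-b} = 29/K`, and an order `T = 12 r > M`
  set M : ℝ := (29 / K) ^ (1 / (2 - b)) with hM
  have hM0 : 0 ≤ M := Real.rpow_nonneg (by positivity) _
  obtain ⟨r₀, hr₀⟩ := exists_nat_gt M
  set r := r₀ + 1 with hrdef
  have hr : 1 ≤ r := by omega
  obtain ⟨hpb, hvarP, hinfP⟩ := chebyshev_calibration r hr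
  have hk1 : 1 ≤ 4 * (3 * r) := by omega
  obtain ⟨i, hi⟩ := h (144 * r ^ 2) (4 * (3 * r)) _ hk1 hpb (lt_of_lt_of_le hv0 hvarP)
  have hinf := hinfP i
  set V := boolVariance ((Polynomial.aeval (∑ i : Fin (144 * r ^ 2),
        (MvPolynomial.C (1 / ((144 * r ^ 2 : ℕ) : ℝ)) -
          MvPolynomial.C (2 / ((144 * r ^ 2 : ℕ) : ℝ)) * MvPolynomial.X i))
        (Polynomial.Chebyshev.T ℝ ((4 * (3 * r) : ℕ) : ℤ))) ^ 2) with hV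
  set k : ℝ := ((4 * (3 * r) : ℕ) : ℝ) with hkdef
  have hkr : k = 12 * r := by rw [hkdef]; push_cast; ring
  have hr0 : (0 : ℝ) < r := by exact_mod_cast (show 0 < r by omega)
  have hkpos : 0 < k := by rw [hkr]; positivity
  have hkM : M < k := by
    have : (r₀ : ℝ) + 1 = r := by rw [hrdef]; push_cast; ring
    rw [hkr]; nlinarith
  -- `K / k^b ≤ C V^a / k^b ≤ Inf_i ≤ 29 / k^2`
  have hkb : 0 < k ^ b := Real.rpow_pos_of_pos hkpos b
  have hVa : v ^ a ≤ V ^ a := pow_le_pow_left₀ hv0.le hvarP a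
  have h1 : K / k ^ b ≤ 29 / k ^ 2 := by
    calc K / k ^ b ≤ C * V ^ a / k ^ b :=
          div_le_div_of_nonneg_right (mul_le_mul_of_nonneg_left hVa hC.le) hkb.le
      _ ≤ _ := hi
      _ ≤ 29 / k ^ 2 := hinf
  -- i.e. `K · k^{2-b} ≤ 29`
  have hsplit : k ^ 2 = k ^ b * k ^ (2 - b) := by
    rw [← Real.rpow_add hkpos, show b + (2 - b) = (2 : ℝ) by ring]
    exact_mod_cast (Real.rpow_natCast k 2).symm
  have h2 : K * k ^ (2 - b) ≤ 29 := by
    rw [div_le_div_iff₀ hkb (by positivity), hsplit] at h1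
    have hkb' : 0 < k ^ b := hkb
    nlinarith [h1, Real.rpow_pos_of_pos hkpos (2 - b)]
  -- but `k^{2-b} > M^{2-b} = 29/K`
  have h3 : M ^ (2 - b) < k ^ (2 - b) := Real.rpow_lt_rpow hM0 hkM he
  have hMe : M ^ (2 - b) = 29 / K := by
    rw [hM, ← Real.rpow_mul (by positivity), one_div_mul_cancel he.ne', Real.rpow_one]
  rw [hMe] at h3
  have h4 : 29 < K * k ^ (2 - b) := by
    have := mul_lt_mul_of_pos_left h3 hK0
    rwa [mul_div_cancel₀ _ hK0.ne'] at this
  linarith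

end Summit.QuantumAdvantage.QuantumAdvantage.Theorems.SosSandwich

end
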